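import Mathlib.MeasureTheory.Measure.Haar.InnerProductSpace
import Mathlib.Analysis.SpecificLimits.Basic
import Literature.Analysis.FluidPDE.TaoMovingCutoff
import Literature.Analysis.FluidPDE.TaoY6RadialChange
import Literature.Analysis.FluidPDE.DyadicChaining
import HarnessLib

/-!
# The dyadic shell decomposition of an annulus and the ramp weight on its pieces

Analysis/FluidPDE support file for the discharge of the named fact
`Literature.Analysis.FluidPDE.tao2011_nonlinearEstimate` (the nonlinear term `Y₆` of Tao 2011,
Thm. 10.1, arXiv:1108.1165 pp. 32–33). Tao covers the domain `Ω` of the cutoff `η` "by a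
boundedly overlapping collection of balls `Bᵢ` with radius
`rᵢ = (1/100) min(dist(xᵢ, ∂Ω), c^{0.1}δ⁻²)`", so that "`η ∼ c^{-0.1}δ²rᵢ` on `B(xᵢ, 10rᵢ)`"
((10.20), p. 32). In the radial rearrangement the same role is played by **dyadic shells in the
distance to the boundary spheres** of the annulus `a < |x - x₀| < b` (`ℓ = k⁻¹` the width of the
transition layers of the ramp `η = annularRamp k a b |x - x₀|`, `a + 2ℓ < b`):

* `innerShell x₀ a ℓ n = {ℓ/2ⁿ⁺⁴ < |x-x₀| - a ≤ ℓ/2ⁿ⁺³}`, `outerShell x₀ b ℓ n` (mirror),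
  `coreRegion x₀ a b ℓ = {ℓ/8 < |x-x₀| - a, ℓ/8 < b - |x-x₀|}`, and the truncated annuli
  `truncRegion x₀ a b ℓ N = {ℓ/2ᴺ⁺⁴ < |x-x₀| - a, ℓ/2ᴺ⁺⁴ < b - |x-x₀|}`;
* `setIntegral_truncRegion_eq` — for an integrable `F`,
  `∫_{truncRegion N} F = ∫_{core} F + Σ_{n≤N} (∫_{innerShell n} F + ∫_{outerShell n} F)`;
* `tendsto_setIntegral_truncRegion` — `∫_{truncRegion N} F → ∫_{openShell x₀ a b} F`;
* the ramp on the pieces: `η = k(|x-x₀| - a) ≤ 2⁻⁽ⁿ⁺³⁾` on `innerShell n` and on the inner layer,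
  `η = k(b - |x-x₀|)` on the outer layer, `η ≥ kℓ'` above distance `ℓ'` from both spheres.

## Mathlib / tree search

Tree (reused): `openShell`, `mem_openShell` (`TaoY6RadialChange`), `annularRamp_eq_inner`,
`annularRamp_eq_outer`, `annularRamp_def` (`TaoMovingCutoff`), `DyadicChaining.div_two_pow_anti`;
the names `innerShell`/`outerShell` also exist in `SereginSverak2009` (different objects), hence the
`TaoY6` namespace of the sibling files. Mathlib: `tendsto_setIntegral_of_monotone`,
`exists_pow_lt_of_lt_one`, `setIntegral_union`.

## References

* T. Tao, arXiv:1108.1165 (`Tao2011`), §10, proof of Thm. 10.1 ((10.20), p. 32).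
-/

noncomputable section

open MeasureTheory Set Filter Topology Function Metric Finset
open scoped ENNReal NNReal BigOperators

namespace Literature.Analysis.FluidPDE

namespace TaoY6

open DyadicChaining

/-- Local notation for physical space `ℝ³ = EuclideanSpace ℝ (Fin 3)`. -/
local notation "ℝ³" => EuclideanSpace ℝ (Fin 3)

/-! ### The pieces -/

/-- The `n`-th inner dyadic shell `{ℓ/2ⁿ⁺⁴ < |x-x₀| - a ≤ ℓ/2ⁿ⁺³}`. [cite: Tao2011, §10, proof of Thm. 10.1 ((10.20))] -/
def innerShell (x₀ : ℝ³) (a ℓ : ℝ) (n : ℕ) : Set ℝ³ :=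
  {x | ℓ / 2 ^ (n + 4) < ‖x - x₀‖ - a ∧ ‖x - x₀‖ - a ≤ ℓ / 2 ^ (n + 3)}

/-- The `n`-th outer dyadic shell `{ℓ/2ⁿ⁺⁴ < b - |x-x₀| ≤ ℓ/2ⁿ⁺³}`. [cite: Tao2011, §10, proof of Thm. 10.1 ((10.20))] -/
def outerShell (x₀ : ℝ³) (b ℓ : ℝ) (n : ℕ) : Set ℝ³ :=
  {x | ℓ / 2 ^ (n + 4) < b - ‖x - x₀‖ ∧ b - ‖x - x₀‖ ≤ ℓ / 2 ^ (n + 3)}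

/-- The core `{ℓ/8 < |x-x₀| - a, ℓ/8 < b - |x-x₀|}` of the annulus. [cite: Tao2011, §10, proof of Thm. 10.1 ((10.20))] -/
def coreRegion (x₀ : ℝ³) (a b ℓ : ℝ) : Set ℝ³ :=
  {x | ℓ / 8 < ‖x - x₀‖ - a ∧ ℓ / 8 < b - ‖x - x₀‖}

/-- The truncated annulus `{ℓ/2ᴺ⁺⁴ < |x-x₀| - a, ℓ/2ᴺ⁺⁴ < b - |x-x₀|}`. [folklore] -/
def truncRegion (x₀ : ℝ³) (a b ℓ : ℝ) (N : ℕ) : Set ℝ³ :=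
  {x | ℓ / 2 ^ (N + 4) < ‖x - x₀‖ - a ∧ ℓ / 2 ^ (N + 4) < b - ‖x - x₀‖}

section Pieces

variable {x₀ : ℝ³} {a b ℓ : ℝ}

/-- `x ↦ |x - x₀| - a` is continuous. [folklore] -/
theorem continuous_norm_sub_sub_const (x₀ : ℝ³) (a : ℝ) : Continuous fun x : ℝ³ => ‖x - x₀‖ - a :=
  (continuous_id.sub continuous_const).norm.sub continuous_const

/-- `x ↦ b - |x - x₀|` is continuous. [folklore] -/
theorem continuous_const_sub_norm_sub (x₀ : ℝ³) (b : ℝ) : Continuous fun x : ℝ³ => b - ‖x - x₀‖ :=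
  continuous_const.sub (continuous_id.sub continuous_const).norm

/-- The pieces are measurable. [folklore] -/
theorem measurableSet_innerShell (x₀ : ℝ³) (a ℓ : ℝ) (n : ℕ) : MeasurableSet (innerShell x₀ a ℓ n) :=
  (measurableSet_lt measurable_const (continuous_norm_sub_sub_const x₀ a).measurable).inter
    (measurableSet_le (continuous_norm_sub_sub_const x₀ a).measurable measurable_const)

/-- The pieces are measurable. [folklore] -/
theorem measurableSet_outerShell (x₀ : ℝ³) (b ℓ : ℝ) (n : ℕ) : MeasurableSet (outerShell x₀ b ℓ n) :=
  (measurableSet_lt measurable_const (continuous_const_sub_norm_sub x₀ b).measurable).inter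
    (measurableSet_le (continuous_const_sub_norm_sub x₀ b).measurable measurable_const)

/-- The pieces are measurable. [folklore] -/
theorem measurableSet_coreRegion (x₀ : ℝ³) (a b ℓ : ℝ) : MeasurableSet (coreRegion x₀ a b ℓ) :=
  (measurableSet_lt measurable_const (continuous_norm_sub_sub_const x₀ a).measurable).inter
    (measurableSet_lt measurable_const (continuous_const_sub_norm_sub x₀ b).measurable)

/-- The pieces are measurable. [folklore] -/
theorem measurableSet_truncRegion (x₀ : ℝ³) (a b ℓ : ℝ) (N : ℕ) : MeasurableSet (truncRegion x₀ a b ℓ N) :=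
  (measurableSet_lt measurable_const (continuous_norm_sub_sub_const x₀ a).measurable).inter
    (measurableSet_lt measurable_const (continuous_const_sub_norm_sub x₀ b).measurable)

/-- **The recursion for the truncated annuli:** for `a + 2ℓ < b`, `0 < ℓ`,
`truncRegion (N+1) = truncRegion N ∪ innerShell (N+1) ∪ outerShell (N+1)`, the three pieces
being pairwise disjoint. [folklore] -/
theorem truncRegion_succ (hℓ : 0 < ℓ) (hab : a + 2 * ℓ < b) (N : ℕ) :
    truncRegion x₀ a b ℓ (N + 1) =
      truncRegion x₀ a b ℓ N ∪ innerShell x₀ a ℓ (N + 1) ∪ outerShell x₀ b ℓ (N + 1) := by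
  have h1 : ℓ / 2 ^ (N + 1 + 4) ≤ ℓ / 2 ^ (N + 4) := div_two_pow_anti hℓ.le (by omega)
  have h2 : ℓ / 2 ^ (N + 4) ≤ ℓ / 2 ^ 4 := div_two_pow_anti hℓ.le (by omega)
  have h3 : ℓ / 2 ^ 4 = ℓ / 16 := by norm_num
  ext x
  simp only [truncRegion, innerShell, outerShell, mem_setOf_eq, mem_union,
    show N + 1 + 3 = N + 4 by omega]
  constructor
  · rintro ⟨hi, ho⟩
    by_cases hin : ‖x - x₀‖ - a ≤ ℓ / 2 ^ (N + 4)
    · exact Or.inl (Or.inr ⟨hi, hin⟩)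
    · by_cases hout : b - ‖x - x₀‖ ≤ ℓ / 2 ^ (N + 4)
      · exact Or.inr ⟨ho, hout⟩
      · exact Or.inl (Or.inl ⟨not_le.1 hin, not_le.1 hout⟩)
  · rintro ((⟨hi, ho⟩ | ⟨hi, hi'⟩) | ⟨ho, ho'⟩)
    · exact ⟨h1.trans_lt hi, h1.trans_lt ho⟩
    · refine ⟨hi, ?_⟩; linarith
    · refine ⟨?_, ho⟩; linarith

/-- Disjointness: the truncated annulus misses the next inner shell. [folklore] -/
theorem disjoint_truncRegion_innerShell_succ (N : ℕ) :
    Disjoint (truncRegion x₀ a b ℓ N) (innerShell x₀ a ℓ (N + 1)) := by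
  rw [Set.disjoint_left]
  rintro x ⟨hi, -⟩ ⟨-, hi'⟩
  rw [show N + 1 + 3 = N + 4 by omega] at hi'
  linarith

/-- Disjointness: truncated annulus ∪ next inner shell misses the next outer shell. [folklore] -/
theorem disjoint_truncRegion_union_innerShell_outerShell (hℓ : 0 < ℓ) (hab : a + 2 * ℓ < b) (N : ℕ) :
    Disjoint (truncRegion x₀ a b ℓ N ∪ innerShell x₀ a ℓ (N + 1)) (outerShell x₀ b ℓ (N + 1)) := by
  have h2 : ℓ / 2 ^ (N + 4) ≤ ℓ / 2 ^ 4 := div_two_pow_anti hℓ.le (by omega)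
  have h3 : ℓ / 2 ^ 4 = ℓ / 16 := by norm_num
  rw [Set.disjoint_left]
  rintro x (⟨-, ho⟩ | ⟨-, hi'⟩) ⟨-, ho'⟩
  · rw [show N + 1 + 3 = N + 4 by omega] at ho'; linarith
  · rw [show N + 1 + 3 = N + 4 by omega] at ho' hi'; linarith

/-- **The base case:** `truncRegion 0 = coreRegion ∪ innerShell 0 ∪ outerShell 0`. [folklore] -/
theorem truncRegion_zero (hℓ : 0 < ℓ) (hab : a + 2 * ℓ < b) :
    truncRegion x₀ a b ℓ 0 = coreRegion x₀ a b ℓ ∪ innerShell x₀ a ℓ 0 ∪ outerShell x₀ b ℓ 0 := by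
  ext x
  simp only [truncRegion, coreRegion, innerShell, outerShell, mem_setOf_eq, mem_union,
    show (2:ℝ) ^ (0 + 4) = 16 by norm_num, show (2:ℝ) ^ (0 + 3) = 8 by norm_num]
  constructor
  · rintro ⟨hi, ho⟩
    by_cases hin : ‖x - x₀‖ - a ≤ ℓ / 8
    · exact Or.inl (Or.inr ⟨hi, hin⟩)
    · by_cases hout : b - ‖x - x₀‖ ≤ ℓ / 8
      · exact Or.inr ⟨ho, hout⟩
      · exact Or.inl (Or.inl ⟨not_le.1 hin, not_le.1 hout⟩)
  · rintro ((⟨hi, ho⟩ | ⟨hi, hi'⟩) | ⟨ho, ho'⟩)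
    · constructor <;> linarith
    · constructor <;> linarith
    · constructor <;> linarith

/-- Disjointness in the base case. [folklore] -/
theorem disjoint_coreRegion_innerShell_zero :
    Disjoint (coreRegion x₀ a b ℓ) (innerShell x₀ a ℓ 0) := by
  rw [Set.disjoint_left]
  rintro x ⟨hi, -⟩ ⟨-, hi'⟩
  simp only [show (2:ℝ) ^ (0 + 3) = 8 by norm_num] at hi'
  linarith

/-- Disjointness in the base case. [folklore] -/
theorem disjoint_coreRegion_union_innerShell_outerShell_zero (hℓ : 0 < ℓ) (hab : a + 2 * ℓ < b) :
    Disjoint (coreRegion x₀ a b ℓ ∪ innerShell x₀ a ℓ 0) (outerShell x₀ b ℓ 0) := by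
  rw [Set.disjoint_left]
  rintro x (⟨-, ho⟩ | ⟨-, hi'⟩) ⟨-, ho'⟩
  · simp only [show (2:ℝ) ^ (0 + 3) = 8 by norm_num] at ho'; linarith
  · simp only [show (2:ℝ) ^ (0 + 3) = 8 by norm_num] at ho' hi'; linarith

/-! ### Integrals over the truncated annuli -/

/-- The truncated annuli increase. [folklore] -/
theorem monotone_truncRegion (hℓ : 0 ≤ ℓ) : Monotone (truncRegion x₀ a b ℓ) := by
  intro N N' hNN' x hx
  have h := div_two_pow_anti hℓ (show N + 4 ≤ N' + 4 by omega)
  exact ⟨h.trans_lt hx.1, h.trans_lt hx.2⟩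

/-- The truncated annuli exhaust the open annulus `openShell x₀ a b = {a < |x-x₀| < b}`. [folklore] -/
theorem iUnion_truncRegion (hℓ : 0 < ℓ) :
    ⋃ N, truncRegion x₀ a b ℓ N = openShell x₀ a b := by
  ext x
  simp only [mem_iUnion, truncRegion, mem_setOf_eq, mem_openShell]
  constructor
  · rintro ⟨N, h1, h2⟩
    have : 0 < ℓ / 2 ^ (N + 4) := by positivity
    constructor <;> linarith
  · rintro ⟨h1', h2'⟩
    have h1 : 0 < ‖x - x₀‖ - a := by linarith
    have h2 : 0 < b - ‖x - x₀‖ := by linarith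
    set d := min (‖x - x₀‖ - a) (b - ‖x - x₀‖) with hd
    have hd0 : 0 < d := lt_min h1 h2
    obtain ⟨N, hN⟩ := exists_pow_lt_of_lt_one (div_pos hd0 hℓ) (by norm_num : (2⁻¹ : ℝ) < 1)
    refine ⟨N, ?_, ?_⟩
    · have : ℓ / 2 ^ (N + 4) < d := by
        have e : ℓ / 2 ^ (N + 4) ≤ ℓ * (2⁻¹) ^ N := by
          rw [inv_pow, ← div_eq_mul_inv]
          exact div_two_pow_anti hℓ.le (by omega)
        have : ℓ * (2⁻¹ : ℝ) ^ N < d := by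
          have := mul_lt_mul_of_pos_left hN hℓ
          rwa [mul_div_cancel₀ _ hℓ.ne'] at this
        linarith
      exact this.trans_le (min_le_left _ _)
    · have : ℓ / 2 ^ (N + 4) < d := by
        have e : ℓ / 2 ^ (N + 4) ≤ ℓ * (2⁻¹) ^ N := by
          rw [inv_pow, ← div_eq_mul_inv]
          exact div_two_pow_anti hℓ.le (by omega)
        have : ℓ * (2⁻¹ : ℝ) ^ N < d := by
          have := mul_lt_mul_of_pos_left hN hℓ
          rwa [mul_div_cancel₀ _ hℓ.ne'] at this
        linarith
      exact this.trans_le (min_le_right _ _)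

/-- **Decomposition of integrals:** for `F` integrable,
`∫_{truncRegion N} F = ∫_{core} F + Σ_{n≤N} (∫_{innerShell n} F + ∫_{outerShell n} F)`. [folklore] -/
theorem setIntegral_truncRegion_eq (hℓ : 0 < ℓ) (hab : a + 2 * ℓ < b) {F : ℝ³ → ℝ}
    (hF : IntegrableOn F (openShell x₀ a b) volume) (N : ℕ) :
    ∫ x in truncRegion x₀ a b ℓ N, F x =
      (∫ x in coreRegion x₀ a b ℓ, F x) +
        ∑ n ∈ range (N + 1), ((∫ x in innerShell x₀ a ℓ n, F x) + ∫ x in outerShell x₀ b ℓ n, F x) := by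
  -- every piece lies in the annulus
  have hT : ∀ N, IntegrableOn F (truncRegion x₀ a b ℓ N) volume := fun N =>
    hF.mono_set (by rw [← iUnion_truncRegion (x₀ := x₀) (a := a) (b := b) hℓ]; exact subset_iUnion _ N)
  have hI : ∀ n, IntegrableOn F (innerShell x₀ a ℓ n) volume := fun n =>
    hF.mono_set fun x hx => by
      have h0 : 0 < ℓ / 2 ^ (n + 4) := by positivity
      have h3 : ℓ / 2 ^ (n + 3) ≤ ℓ := by
        calc ℓ / 2 ^ (n + 3) ≤ ℓ / 2 ^ 0 := div_two_pow_anti hℓ.le (Nat.zero_le _)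
          _ = ℓ := by norm_num
      rw [mem_openShell]; constructor <;> linarith [hx.1, hx.2]
  have hO : ∀ n, IntegrableOn F (outerShell x₀ b ℓ n) volume := fun n =>
    hF.mono_set fun x hx => by
      have h0 : 0 < ℓ / 2 ^ (n + 4) := by positivity
      have h3 : ℓ / 2 ^ (n + 3) ≤ ℓ := by
        calc ℓ / 2 ^ (n + 3) ≤ ℓ / 2 ^ 0 := div_two_pow_anti hℓ.le (Nat.zero_le _)
          _ = ℓ := by norm_num
      rw [mem_openShell]; constructor <;> linarith [hx.1, hx.2]
  have hC : IntegrableOn F (coreRegion x₀ a b ℓ) volume :=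
    hF.mono_set fun x hx => by rw [mem_openShell]; constructor <;> linarith [hx.1, hx.2]
  induction N with
  | zero =>
    rw [truncRegion_zero hℓ hab, setIntegral_union (disjoint_coreRegion_union_innerShell_outerShell_zero hℓ hab)
        (measurableSet_outerShell _ _ _ _) (hC.union (hI 0)) (hO 0),
      setIntegral_union disjoint_coreRegion_innerShell_zero (measurableSet_innerShell _ _ _ _) hC (hI 0)]
    simp only [zero_add, range_one, sum_singleton]
    ring
  | succ N ih =>
    rw [truncRegion_succ hℓ hab N,
      setIntegral_union (disjoint_truncRegion_union_innerShell_outerShell hℓ hab N)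
        (measurableSet_outerShell _ _ _ _) ((hT N).union (hI (N + 1))) (hO (N + 1)),
      setIntegral_union (disjoint_truncRegion_innerShell_succ N) (measurableSet_innerShell _ _ _ _)
        (hT N) (hI (N + 1)), ih, sum_range_succ _ (N + 1)]
    ring

/-- **Exhaustion of the integral:** `∫_{truncRegion N} F → ∫_{openShell x₀ a b} F` for `F`
integrable on the annulus. [folklore] -/
theorem tendsto_setIntegral_truncRegion (hℓ : 0 < ℓ) {F : ℝ³ → ℝ}
    (hF : IntegrableOn F (openShell x₀ a b) volume) :
    Tendsto (fun N => ∫ x in truncRegion x₀ a b ℓ N, F x) atTop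
      (𝓝 (∫ x in openShell x₀ a b, F x)) := by
  rw [← iUnion_truncRegion (x₀ := x₀) (a := a) (b := b) hℓ] at hF ⊢
  exact tendsto_setIntegral_of_monotone (fun N => measurableSet_truncRegion x₀ a b ℓ N)
    (monotone_truncRegion hℓ.le) hF

/-! ### The ramp weight on the pieces -/

/-- **On the inner layer `0 ≤ |x-x₀| - a ≤ ℓ` the ramp is `k(|x-x₀| - a)`** (`k = ℓ⁻¹`,
`a + 2ℓ < b`). [folklore] -/
theorem annularRamp_eq_mul_dist_inner (hℓ : 0 < ℓ) (hab : a + 2 * ℓ < b) {x : ℝ³}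
    (h0 : 0 ≤ ‖x - x₀‖ - a) (h1 : ‖x - x₀‖ - a ≤ ℓ) :
    annularRamp ℓ⁻¹ a b ‖x - x₀‖ = ℓ⁻¹ * (‖x - x₀‖ - a) := by
  rw [annularRamp_eq_inner (inv_pos.2 hℓ) (by linarith) (by rw [inv_inv]; linarith)
    (by rw [inv_inv]; linarith)]

/-- **On the outer layer `0 ≤ b - |x-x₀| ≤ ℓ` the ramp is `k(b - |x-x₀|)`.** [folklore] -/
theorem annularRamp_eq_mul_dist_outer (hℓ : 0 < ℓ) (hab : a + 2 * ℓ < b) {x : ℝ³}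
    (h0 : 0 ≤ b - ‖x - x₀‖) (h1 : b - ‖x - x₀‖ ≤ ℓ) :
    annularRamp ℓ⁻¹ a b ‖x - x₀‖ = ℓ⁻¹ * (b - ‖x - x₀‖) := by
  rw [annularRamp_eq_outer (inv_pos.2 hℓ) (by rw [inv_inv]; linarith) (by rw [inv_inv]; linarith)
    (by linarith)]

/-- **Lower bound away from both spheres:** if `ℓ' ≤ |x-x₀| - a`, `ℓ' ≤ b - |x-x₀|` with
`ℓ' ≤ ℓ`, then `kℓ' ≤ η(x)`. [folklore] -/
theorem mul_le_annularRamp_of_le_dist (hℓ : 0 < ℓ) {ℓ' : ℝ}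
    (hℓ' : ℓ' ≤ ℓ) {x : ℝ³} (hi : ℓ' ≤ ‖x - x₀‖ - a) (ho : ℓ' ≤ b - ‖x - x₀‖) :
    ℓ⁻¹ * ℓ' ≤ annularRamp ℓ⁻¹ a b ‖x - x₀‖ := by
  have hk : 0 < ℓ⁻¹ := inv_pos.2 hℓ
  have hkl : ℓ⁻¹ * ℓ' ≤ 1 := by rw [inv_mul_le_iff₀ hℓ]; linarith
  rw [annularRamp_def]
  refine le_min hkl (le_min ?_ ?_)
  · exact le_max_of_le_right (mul_le_mul_of_nonneg_left ho hk.le)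
  · exact le_max_of_le_right (mul_le_mul_of_nonneg_left hi hk.le)

/-- On the `n`-th inner shell, `η ≤ 2⁻⁽ⁿ⁺³⁾` and `η = k(|x-x₀| - a)`. [folklore] -/
theorem annularRamp_le_of_mem_innerShell (hℓ : 0 < ℓ) (hab : a + 2 * ℓ < b) {n : ℕ} {x : ℝ³}
    (hx : x ∈ innerShell x₀ a ℓ n) :
    annularRamp ℓ⁻¹ a b ‖x - x₀‖ = ℓ⁻¹ * (‖x - x₀‖ - a) ∧
      annularRamp ℓ⁻¹ a b ‖x - x₀‖ ≤ (2 ^ (n + 3))⁻¹ := by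
  have h8 : ℓ / 2 ^ (n + 3) ≤ ℓ := by
    calc ℓ / 2 ^ (n + 3) ≤ ℓ / 2 ^ 0 := div_two_pow_anti hℓ.le (Nat.zero_le _)
      _ = ℓ := by norm_num
  have hpos : 0 < ℓ / 2 ^ (n + 4) := by positivity
  have heq := annularRamp_eq_mul_dist_inner hℓ hab (hpos.le.trans hx.1.le) (hx.2.trans h8)
  refine ⟨heq, ?_⟩
  rw [heq]
  calc ℓ⁻¹ * (‖x - x₀‖ - a) ≤ ℓ⁻¹ * (ℓ / 2 ^ (n + 3)) :=
        mul_le_mul_of_nonneg_left hx.2 (inv_nonneg.2 hℓ.le)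
    _ = (2 ^ (n + 3))⁻¹ := by field_simp

/-- On the `n`-th outer shell, `η ≤ 2⁻⁽ⁿ⁺³⁾` and `η = k(b - |x-x₀|)`. [folklore] -/
theorem annularRamp_le_of_mem_outerShell (hℓ : 0 < ℓ) (hab : a + 2 * ℓ < b) {n : ℕ} {x : ℝ³}
    (hx : x ∈ outerShell x₀ b ℓ n) :
    annularRamp ℓ⁻¹ a b ‖x - x₀‖ = ℓ⁻¹ * (b - ‖x - x₀‖) ∧
      annularRamp ℓ⁻¹ a b ‖x - x₀‖ ≤ (2 ^ (n + 3))⁻¹ := by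
  have h8 : ℓ / 2 ^ (n + 3) ≤ ℓ := by
    calc ℓ / 2 ^ (n + 3) ≤ ℓ / 2 ^ 0 := div_two_pow_anti hℓ.le (Nat.zero_le _)
      _ = ℓ := by norm_num
  have hpos : 0 < ℓ / 2 ^ (n + 4) := by positivity
  have heq := annularRamp_eq_mul_dist_outer hℓ hab (hpos.le.trans hx.1.le) (hx.2.trans h8)
  refine ⟨heq, ?_⟩
  rw [heq]
  calc ℓ⁻¹ * (b - ‖x - x₀‖) ≤ ℓ⁻¹ * (ℓ / 2 ^ (n + 3)) :=
        mul_le_mul_of_nonneg_left hx.2 (inv_nonneg.2 hℓ.le)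
    _ = (2 ^ (n + 3))⁻¹ := by field_simp

end Pieces

end TaoY6

end Literature.Analysis.FluidPDE

end
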